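import Literature.NumberTheory.EllipticCurves.CongruentNumberOddMonskySelmerBound
import HarnessLib

/-!
# Monsky's `2`-Selmer formula for `E_n`, `n = p₁⋯p_k` ODD, `≥` half, I: the relations carried by a kernel vector

Companion ("lower bound") of `CongruentNumberOddMonskySelmer{Local,Bound}.lean` (`#Sel⁽²⁾(E_n/ℚ) ≤ 2^{2+s(n)}`,
`2^{s} = #ker M`, `M = ( A + D₂  D₂ ; D₂  A + D₋₂ )` Monsky's matrix for odd `D = p₁⋯p_k`, appendix to Heath-Brown,
Invent. Math. 118 (1994), typescript p. 39). There a normalised Selmer class (`v₂(a) = 0`, `b > 0`) was sent to its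
coordinates `(x; y) = (v_{pᵢ}(a); v_{pᵢ}(a) + v_{pᵢ}(b))` in `ker M`. For the converse one attaches to
`(x; y) ∈ ker M` the pair `(a, b) = (∏ pᵢ^{xᵢ}, ∏ pᵢ^{xᵢ+yᵢ})` and needs, from `M(x; y) = 0`:

* `rel_inl` / `rel_inr` — the two block rows: `Σ_{j≠i} A_ij xⱼ = xᵢ(A_ii + wᵢ) + wᵢyᵢ` and
  `Σ_{j≠i} A_ij yⱼ = wᵢxᵢ + yᵢ(A_ii + uᵢ + wᵢ)` (`[−2] = [−1] + [2]`), which give the `I₀*` relations of the pair at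
  `pᵢ` (`rel_a`, `rel_b`);
* `sum_double_eq` — `Σᵢ Σ_{j≠i} A_ij zⱼ = Σⱼ A_jj zⱼ + |u|·Σ uⱼzⱼ + Σ uⱼzⱼ` (column sums of `A` by quadratic
  reciprocity `A + Aᵀ = D₋₁ + uᵀu`);
* the SUMMED relations `chi4_rel : Σ uⱼxⱼ = |u|·Σ uⱼ(xⱼ+yⱼ)` and `chi8_rel : Σ wⱼ(xⱼ+yⱼ) = 0` — the `2`-ADIC
  conditions `χ₄(a) = χ₄(n)χ₄(b)`, `χ₈(b) = 0` of the odd case (Heath-Brown 1993, Lemma 2: "for the prime `p = 2`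
  no further condition is required").

Pure `𝔽₂`-linear algebra (theorems only); no named fact. Cell `bsd-monsky` (prover-B).

## References

* [HeathBrown1994SelmerCongruentII] D. R. Heath-Brown, Invent. Math. 118 (1994) 331–370, Appendix
  (P. Monsky): typescript p. 38 L24–L31, p. 39 L1–L41.
* [SilvermanAEC2009] J. H. Silverman, *The Arithmetic of Elliptic Curves*, 2nd ed., Prop. X.1.4, Example X.1.5.
-/

noncomputable section

open scoped Classical

open Literature.NumberTheory.EllipticCurves.HeathBrown1994
open Literature.NumberTheory.EllipticCurves.CongruentNumberEvenMonskySelmer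
open Literature.NumberTheory.EllipticCurves.CongruentNumberOddMonskySelmer
open Matrix

namespace Literature.NumberTheory.EllipticCurves

namespace CongruentNumberOddMonskySelmerKernel

variable {k : ℕ} {p : Fin k → ℕ}

/-! ## §0 Bookkeeping in `ℤ/2` -/

/-- `2 = 0` in `ℤ/2`. [folklore] -/
private theorem two_eq_zero : (2 : ZMod 2) = 0 := by decide

/-- `u·u = u` in `ℤ/2`. [folklore] -/
private theorem mul_self_zmod2 (u : ZMod 2) : u * u = u := by revert u; decide

/-- Swapping a double sum over `j ≠ i`. [folklore] -/
private theorem sum_erase_comm (f : Fin k → Fin k → ZMod 2) :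
    ∑ i, ∑ j ∈ Finset.univ.erase i, f i j = ∑ j, ∑ i ∈ Finset.univ.erase j, f i j :=
  Finset.sum_comm' fun i j => by
    simp only [Finset.mem_univ, Finset.mem_erase, ne_eq, true_and, and_true]
    exact ⟨fun h => Ne.symm h, fun h => Ne.symm h⟩

/-! ## §1 Column sums of `A` by quadratic reciprocity -/

/-- **`Σᵢ Σ_{j≠i} A_ij zⱼ = Σⱼ A_jj zⱼ + |u|·(Σⱼ uⱼzⱼ) + Σⱼ uⱼzⱼ`** (`A_ij = [(pⱼ/pᵢ) = −1]`, `A_jj = Σ_{l≠j} A_jl`,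
`uⱼ = [(−1/pⱼ) = −1]`, `|u| = Σ uⱼ`): the column sums of `A` are `A_jj + uⱼ(|u| − uⱼ)` by `A + Aᵀ = D₋₁ + uᵀu`.
[cite: HeathBrown1994SelmerCongruentII, Appendix (Monsky), typescript p. 39 L37 – p. 40 L1] -/
theorem sum_double_eq (hp : ∀ i, (p i).Prime) (hp2 : ∀ i, p i ≠ 2) (hinj : Function.Injective p)
    (z : Fin k → ZMod 2) :
    ∑ i, ∑ j ∈ Finset.univ.erase i, addLegendreSym (p j) (p i) * z j =
      ∑ j, (∑ l ∈ Finset.univ.erase j, addLegendreSym (p l) (p j)) * z j +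
        (∑ j, addLegendreSym (-1) (p j)) * ∑ j, addLegendreSym (-1) (p j) * z j +
        ∑ j, addLegendreSym (-1) (p j) * z j := by
  rw [sum_erase_comm]
  have hinner : ∀ j, ∑ i ∈ Finset.univ.erase j, addLegendreSym (p j) (p i) * z j =
      (∑ l ∈ Finset.univ.erase j, addLegendreSym (p l) (p j)) * z j +
        (∑ l, addLegendreSym (-1) (p l)) * (addLegendreSym (-1) (p j) * z j) +
        addLegendreSym (-1) (p j) * z j := by
    intro j
    have hQR : ∑ i ∈ Finset.univ.erase j, addLegendreSym (p j) (p i) * z j =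
        ∑ i ∈ Finset.univ.erase j, addLegendreSym (p i) (p j) * z j +
          addLegendreSym (-1) (p j) * z j * ∑ i ∈ Finset.univ.erase j, addLegendreSym (-1) (p i) := by
      rw [Finset.mul_sum, ← Finset.sum_add_distrib]
      exact Finset.sum_congr rfl fun i hi => by
        rw [addLegendreSym_swap (hp i) (hp j) (hp2 i) (hp2 j) (fun h => Finset.ne_of_mem_erase hi (hinj h))]
        ring
    have hsplit := Finset.add_sum_erase Finset.univ (fun l => addLegendreSym (-1) (p l)) (Finset.mem_univ j)
    have hDm := mul_self_zmod2 (addLegendreSym (-1) (p j))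
    rw [hQR, Finset.sum_mul]
    set U := ∑ l, addLegendreSym (-1) (p l)
    set Ue := ∑ i ∈ Finset.univ.erase j, addLegendreSym (-1) (p i)
    linear_combination (addLegendreSym (-1) (p j) * z j) * hsplit - z j * hDm -
      (addLegendreSym (-1) (p j) * z j) * two_eq_zero
  simp only [hinner, Finset.sum_add_distrib, ← Finset.mul_sum]

/-! ## §2 The relations carried by a kernel vector of `M = ( A + D₂  D₂ ; D₂  A + D₋₂ )` -/

section Kernel

variable (hp : ∀ i, (p i).Prime) (hp2 : ∀ i, p i ≠ 2) (hinj : Function.Injective p)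
variable {x y : Fin k → ZMod 2} (hx : monskyMatrixOdd p *ᵥ Sum.elim x y = 0)
include hx

/-- **The first block row** (`(A + D₂)x + D₂y = 0`) at `i`: `Σ_{j≠i} A_ij xⱼ = xᵢ(A_ii + wᵢ) + wᵢyᵢ`.
[cite: HeathBrown1994SelmerCongruentII, Appendix (Monsky), typescript p. 39 L27–L33] -/
theorem rel_inl (i : Fin k) :
    ∑ j ∈ Finset.univ.erase i, addLegendreSym (p j) (p i) * x j =
      x i * ((∑ l ∈ Finset.univ.erase i, addLegendreSym (p l) (p i)) + addLegendreSym 2 (p i)) +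
        addLegendreSym 2 (p i) * y i := by
  obtain ⟨E1, -⟩ := monskyMatrixOdd_mulVec_apply (p := p) x y i
  rw [hx, Pi.zero_apply] at E1
  linear_combination -E1 - (x i * ∑ l ∈ Finset.univ.erase i, addLegendreSym (p l) (p i) +
    x i * addLegendreSym 2 (p i) + addLegendreSym 2 (p i) * y i) * two_eq_zero

include hp hp2 in
/-- **The second block row** (`D₂x + (A + D₋₂)y = 0`) at `i`: `Σ_{j≠i} A_ij yⱼ = wᵢxᵢ + yᵢ(A_ii + uᵢ + wᵢ)`
(`[−2] = [−1] + [2]`). [cite: HeathBrown1994SelmerCongruentII, Appendix (Monsky), typescript p. 39 L27–L33] -/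
theorem rel_inr (i : Fin k) :
    ∑ j ∈ Finset.univ.erase i, addLegendreSym (p j) (p i) * y j =
      addLegendreSym 2 (p i) * x i +
        y i * ((∑ l ∈ Finset.univ.erase i, addLegendreSym (p l) (p i)) + addLegendreSym (-1) (p i) +
          addLegendreSym 2 (p i)) := by
  obtain ⟨-, E2⟩ := monskyMatrixOdd_mulVec_apply (p := p) x y i
  rw [hx, Pi.zero_apply, addLegendreSym_neg_two (hp i) (hp2 i)] at E2
  linear_combination -E2 - (addLegendreSym 2 (p i) * x i +
    y i * ∑ l ∈ Finset.univ.erase i, addLegendreSym (p l) (p i) + y i * addLegendreSym (-1) (p i) +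
    y i * addLegendreSym 2 (p i)) * two_eq_zero

/-- **The `I₀*` relation for `a = ∏ pᵢ^{xᵢ}` at `pᵢ`**: `Σ_{j≠i} A_ij xⱼ = xᵢ·A_ii + (xᵢ + yᵢ)·wᵢ`
(`qr(a) = α·qr(n) + β·qr(2)` with `α = x`, `β = x + y`).
[cite: HeathBrown1994SelmerCongruentII, Appendix (Monsky), typescript p. 38 L24–L31] -/
theorem rel_a (i : Fin k) :
    ∑ j ∈ Finset.univ.erase i, addLegendreSym (p j) (p i) * x j =
      x i * (∑ l ∈ Finset.univ.erase i, addLegendreSym (p l) (p i)) + (x i + y i) * addLegendreSym 2 (p i) := by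
  rw [rel_inl hx i]; ring

include hp hp2 in
/-- **The `I₀*` relation for `b = ∏ pᵢ^{xᵢ+yᵢ}` at `pᵢ`**:
`Σ_{j≠i} A_ij (xⱼ + yⱼ) = xᵢ·uᵢ + (xᵢ + yᵢ)·(uᵢ + A_ii)` (`qr(b) = α·qr(−1) + β·(qr(−1) + qr(n))`).
[cite: HeathBrown1994SelmerCongruentII, Appendix (Monsky), typescript p. 38 L24–L31] -/
theorem rel_b (i : Fin k) :
    ∑ j ∈ Finset.univ.erase i, addLegendreSym (p j) (p i) * (x j + y j) =
      x i * addLegendreSym (-1) (p i) +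
        (x i + y i) * (addLegendreSym (-1) (p i) + ∑ l ∈ Finset.univ.erase i, addLegendreSym (p l) (p i)) := by
  have h1 := rel_inl hx i
  have h2 := rel_inr hp hp2 hx i
  have hsplit : ∑ j ∈ Finset.univ.erase i, addLegendreSym (p j) (p i) * (x j + y j) =
      ∑ j ∈ Finset.univ.erase i, addLegendreSym (p j) (p i) * x j +
        ∑ j ∈ Finset.univ.erase i, addLegendreSym (p j) (p i) * y j := by
    rw [← Finset.sum_add_distrib]; exact Finset.sum_congr rfl fun j _ => by ring
  rw [hsplit, h1, h2]
  linear_combination (x i * addLegendreSym 2 (p i) + addLegendreSym 2 (p i) * y i -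
    x i * addLegendreSym (-1) (p i)) * two_eq_zero

include hp hp2 hinj in
/-- **Summed first block rows**: `|u|·Σuⱼxⱼ + Σuⱼxⱼ + Σwⱼxⱼ + Σwⱼyⱼ = 0`.
[cite: HeathBrown1994SelmerCongruentII, Appendix (Monsky), typescript p. 39 L37 – p. 40 L5] -/
theorem sum_inl :
    (∑ j, addLegendreSym (-1) (p j)) * (∑ j, addLegendreSym (-1) (p j) * x j) + ∑ j, addLegendreSym (-1) (p j) * x j +
      ∑ j, addLegendreSym 2 (p j) * x j + ∑ j, addLegendreSym 2 (p j) * y j = 0 := by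
  have hsum : ∑ i, (monskyMatrixOdd p *ᵥ Sum.elim x y) (Sum.inl i) = 0 := by rw [hx]; simp
  have hrows : ∀ i, (monskyMatrixOdd p *ᵥ Sum.elim x y) (Sum.inl i) =
      ((∑ l ∈ Finset.univ.erase i, addLegendreSym (p l) (p i)) * x i +
          ∑ j ∈ Finset.univ.erase i, addLegendreSym (p j) (p i) * x j) +
        addLegendreSym 2 (p i) * x i + addLegendreSym 2 (p i) * y i :=
    fun i => (monskyMatrixOdd_mulVec_apply (p := p) x y i).1
  simp only [hrows, Finset.sum_add_distrib] at hsum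
  rw [sum_double_eq hp hp2 hinj x] at hsum
  set D := ∑ j, (∑ l ∈ Finset.univ.erase j, addLegendreSym (p l) (p j)) * x j
  linear_combination hsum - D * two_eq_zero

include hp hp2 hinj in
/-- **Summed second block rows**: `Σwⱼxⱼ + |u|·Σuⱼyⱼ + Σwⱼyⱼ = 0`.
[cite: HeathBrown1994SelmerCongruentII, Appendix (Monsky), typescript p. 39 L37 – p. 40 L5] -/
theorem sum_inr :
    ∑ j, addLegendreSym 2 (p j) * x j +
      (∑ j, addLegendreSym (-1) (p j)) * (∑ j, addLegendreSym (-1) (p j) * y j) + ∑ j, addLegendreSym 2 (p j) * y j = 0 := by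
  have hsum : ∑ i, (monskyMatrixOdd p *ᵥ Sum.elim x y) (Sum.inr i) = 0 := by rw [hx]; simp
  have hrows : ∀ i, (monskyMatrixOdd p *ᵥ Sum.elim x y) (Sum.inr i) =
      addLegendreSym 2 (p i) * x i +
        (((∑ l ∈ Finset.univ.erase i, addLegendreSym (p l) (p i)) * y i +
            ∑ j ∈ Finset.univ.erase i, addLegendreSym (p j) (p i) * y j) +
          (addLegendreSym (-1) (p i) + addLegendreSym 2 (p i)) * y i) := by
    intro i
    rw [(monskyMatrixOdd_mulVec_apply (p := p) x y i).2, addLegendreSym_neg_two (hp i) (hp2 i)]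
  simp only [hrows, Finset.sum_add_distrib, add_mul] at hsum
  rw [sum_double_eq hp hp2 hinj y] at hsum
  set D := ∑ j, (∑ l ∈ Finset.univ.erase j, addLegendreSym (p l) (p j)) * y j
  set Uy := ∑ j, addLegendreSym (-1) (p j) * y j
  set Wy := ∑ j, addLegendreSym 2 (p j) * y j
  linear_combination hsum - (D + Uy) * two_eq_zero

include hp hp2 hinj in
/-- **The `χ₄` condition at `2`: `Σuⱼxⱼ = |u|·Σuⱼ(xⱼ + yⱼ)`** — `χ₄(a) = χ₄(n)·χ₄(b)` for the pair
`(∏pᵢ^{xᵢ}, ∏pᵢ^{xᵢ+yᵢ})`. [cite: HeathBrown1994SelmerCongruentII, Appendix (Monsky), typescript p. 39 L37 – p. 40 L5] -/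
theorem chi4_rel :
    ∑ j, addLegendreSym (-1) (p j) * x j =
      (∑ j, addLegendreSym (-1) (p j)) * ∑ j, addLegendreSym (-1) (p j) * (x j + y j) := by
  have h1 := sum_inl hp hp2 hinj hx
  have h2 := sum_inr hp hp2 hinj hx
  have hsplit : ∑ j, addLegendreSym (-1) (p j) * (x j + y j) =
      ∑ j, addLegendreSym (-1) (p j) * x j + ∑ j, addLegendreSym (-1) (p j) * y j := by
    rw [← Finset.sum_add_distrib]; exact Finset.sum_congr rfl fun j _ => by ring
  rw [hsplit]
  set U := ∑ j, addLegendreSym (-1) (p j)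
  set Ux := ∑ j, addLegendreSym (-1) (p j) * x j
  set Uy := ∑ j, addLegendreSym (-1) (p j) * y j
  set Wx := ∑ j, addLegendreSym 2 (p j) * x j
  set Wy := ∑ j, addLegendreSym 2 (p j) * y j
  linear_combination h1 - h2 - (U * Ux) * two_eq_zero

include hp hp2 hinj in
/-- **The `χ₈` condition at `2`: `Σwⱼ(xⱼ + yⱼ) = 0`** — `χ₈(b) = 0` for the pair `(∏pᵢ^{xᵢ}, ∏pᵢ^{xᵢ+yᵢ})`.
[cite: HeathBrown1994SelmerCongruentII, Appendix (Monsky), typescript p. 39 L37 – p. 40 L5] -/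
theorem chi8_rel : ∑ j, addLegendreSym 2 (p j) * (x j + y j) = 0 := by
  have h1 := sum_inl hp hp2 hinj hx
  have h4 := chi4_rel hp hp2 hinj hx
  have hsplit : ∑ j, addLegendreSym (-1) (p j) * (x j + y j) =
      ∑ j, addLegendreSym (-1) (p j) * x j + ∑ j, addLegendreSym (-1) (p j) * y j := by
    rw [← Finset.sum_add_distrib]; exact Finset.sum_congr rfl fun j _ => by ring
  have hsplit' : ∑ j, addLegendreSym 2 (p j) * (x j + y j) =
      ∑ j, addLegendreSym 2 (p j) * x j + ∑ j, addLegendreSym 2 (p j) * y j := by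
    rw [← Finset.sum_add_distrib]; exact Finset.sum_congr rfl fun j _ => by ring
  rw [hsplit] at h4
  rw [hsplit']
  have hUU := mul_self_zmod2 (∑ j, addLegendreSym (-1) (p j))
  set U := ∑ j, addLegendreSym (-1) (p j)
  set Ux := ∑ j, addLegendreSym (-1) (p j) * x j
  set Uy := ∑ j, addLegendreSym (-1) (p j) * y j
  set Wx := ∑ j, addLegendreSym 2 (p j) * x j
  set Wy := ∑ j, addLegendreSym 2 (p j) * y j
  -- `Wx + Wy = (U+1)·Ux` (h1) and `Ux = U(Ux + Uy)` (h4): `(U+1)U = 0`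
  linear_combination h1 - (U + 1) * h4 - (Ux + Uy) * hUU - (U * Ux + U * Uy) * two_eq_zero

end Kernel

end CongruentNumberOddMonskySelmerKernel

end Literature.NumberTheory.EllipticCurves

end
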